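import Summits.BirchSwinnertonDyer.BirchSwinnertonDyer.Theorems.PrintCf2SplitBadTwoNormAtVbarTotallyRamified
import Literature.NumberTheory.GaloisRepresentations.AbsIntegersLocalization
import HarnessLib

/-!
# Crux `PrintCf2.SplitBadTwoRankOneOfFacts` (stmt-BirchSwinnertonDyer-20368), skeleton v13.5, (REG₂) `stub_xRegular_two` FACT-FREE road, R2 brick
# **B5-T, THE TRANSFER STEP**: from `n ∣ ord_{w₀}(z)` in the sign field `Z = K_ε` (output of -w3 g14's FILE 6 socket) to `n ∣ ord_{w′}(b′)` at
# EVERY place `w′ ∣ v̄` of the layer field `F′ = F·K_ε` — units of `\bar ℤ_𝔓` across `Z ⊂ K̄ ⊃ F′` (no ring-of-integer towers), the product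
# `z = ∏_y (s_y|_{F′}) b′`, and `[Γ_K : U] ∣ e(w″ ∣ v̄)`

Cell `bsd-print-cf2`, EXTRA WIDTH seat `bsd-line-cf2-p1-w4` g14 (prover-bsd-line-cf2-p1-w4-g14-0); `--supports stmt-BirchSwinnertonDyer-20368`
(helper, Theses-free). HONEST FRAMING: nothing here closes the crux or a registered stub; BSD is not proved by any of this; no summit
statement is proved by this seat. No definition, no named fact, no `sorry`. UNCONDITIONAL; generic (any number field `K`, any finite
`F′, Z ⊆ K̄`, any prime `𝔓` of `\bar ℤ_K`).

WHY (STATUS 2026-08-29T08:09:58Z split of «B5-T»; my 08:3xZ plan). -w3 g14's socket `dvd_log_valuation_of_mem_dualLocalCondition_unramified_of_decompFixed`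
(FILE 6) reads the twisted `v̄`-clause as `(n : ℤ) ∣ log v_{w₀}(z)` for `z = ∏_y s_y b′ ∈ Z = K_ε` and the place `w₀` of `Z` below
`𝔓₀ = adicCompletionPrime K v̄`; B3d′'s `hB5` wants `(n : ℤ) ∣ log v_{w′}(b′)` at every place `w′ ∣ v̄` of `F′ ∋ b′`. This file is the
passage, by elementary Dedekind/valuation-ring bookkeeping inside ONE algebraic closure:
* §1 `exists_heightOneSpectrum_comap_eq` — the place of a finite `L ⊆ K̄` below a prime `𝔓 ∣ v` of `\bar ℤ_K`;
  **`coe_mem_absIntegersValuationSubring_of_valuation_le_one`** / **`valuation_eq_one_of_coe_mem`** — for `x ∈ L`: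
  `v_{w}(x) ≤ 1 ⟹ x ∈ \bar ℤ_𝔓` and `x, x⁻¹ ∈ \bar ℤ_𝔓 ⟹ v_w(x) = 1` (`w` = the place of `L` below `𝔓`; fractions with denominators outside `w`,
  `PadicEmbedding.exists_mul_eq_of_valuation_le_one`) — so «unit at `w₀` in `Z`» ⟹ «unit of `\bar ℤ_𝔓`» ⟹ «unit at `w″` in `F′`» WITHOUT an
  `Algebra Z F′` tower;
* §2 `log_valuation_prod_smul_eq` — `log v_{w″}(∏_i g_i b′) = #ι · log v_{w″}(b′)` when every `g_i` fixes `w″`;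
* §3 **`index_dvd_ramificationIdx`** — `Γ_K = I_𝔓 · U` (`U = Gal(K̄/F)`, total ramification of `v̄` in `F`) and `Gal(K̄/F′) ≤ U` ⟹
  `[Γ_K : U] ∣ e(w″ ∣ v̄)` for the place `w″` of `F′` below `𝔓` (`#(I_𝔓 mod Gal(K̄/F′)) = [I_𝔓 : I_𝔓 ∩ Gal(K̄/F′)]` is a multiple of
  `[I_𝔓 : I_𝔓 ∩ U] = [Γ_K : U]` and divides `#I(w″ ∣ v̄) = e(w″ ∣ v̄)`, `Ideal.card_inertia_eq_ramificationIdxIn`);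
* §4 **`dvd_log_valuation_of_dvd_log_valuation_subfield`** — THE TRANSFER: `(n : ℤ) ∣ log v_{w₀}(z)`, `e(w₀ ∣ v̄) = 1`, `z = ∏_{i<d} g_i b′` in `F′`
  with the `g_i` fixing `w″`, `d ∣ e(w″ ∣ v̄)` ⟹ `(n : ℤ) ∣ log v_{w″}(b′)` (`z = π^{nk} u`, `π ∈ K` a `v̄`-uniformiser, `u` a `w₀`-unit);
* §5 `dvd_log_valuation_smul_of_dvd` — the `s₀`-conjugate place: `ord_{w″}(s₀ b′) ≡ −ord_{w″}(b′) (mod n)` for `ε(s₀) = −1` (p704813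
  `exists_pow_eq_mul_absRestrictNormalHom`), and `forall_extension_dvd_log_valuation` — every `w′ ∣ v̄` of `F′` is `(σ|_{F′}) • w″`, and in case (B1)
  `σ|_{F′} • w″ ∈ {w″, s₀ • w″}` up to elements fixing both ⟹ `(n : ℤ) ∣ log v_{w′}(b′)` for ALL `w′`.
presearch: «valuation ring of algebraic integers localized at a prime restricted to a number field», «ramification index divisible inertia
surjects» → Neukirch ANT I §9, II §8 (8.1)–(8.5); Serre *Local Fields* I §7; folklore, no new fact. beyond-print theorem: no.

References: [NeukirchANT1999] Ch. I §9 (9.4), (9.6), Ch. II §8 (8.1)–(8.5); [SerreLocalFields1979] I §7 Prop. 21–22; [NeukirchSchmidtWingberg2008] I §5.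
-/

noncomputable section

open scoped Classical Pointwise

set_option linter.dupNamespace false
set_option autoImplicit false

open NumberField IsDedekindDomain Field IntermediateField
open Literature.NumberTheory.EllipticCurves Literature.NumberTheory.EllipticCurves.GreenbergSelmer
open Literature.NumberTheory.GaloisRepresentations Literature.NumberTheory.GaloisRepresentations.LocalWeilDatum

namespace Summit.BirchSwinnertonDyer.BirchSwinnertonDyer.Theorems.PrintCf2.NormAtVbar

/-! ## §1. Units of `\bar ℤ_𝔓` versus units at the place below `𝔓` -/

section Units

variable {K : Type} [Field K] [NumberField K] (L : IntermediateField K (AlgebraicClosure K)) [NumberField L]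
  (𝔓 : Ideal (absIntegers (𝓞 K) K))

/-- **The place of a finite `L ⊆ K̄` below a prime `𝔓 ∣ v` of `\bar ℤ_K`**: a nonzero prime `w` of `𝓞 L` with `𝔓 ∩ 𝓞 L = 𝔭_w`, lying over
`v`. [cite: NeukirchANT1999, Ch. I §9 (9.1)] -/
theorem exists_heightOneSpectrum_comap_eq {v : HeightOneSpectrum (𝓞 K)} (h𝔓 : 𝔓 ∈ v.primesAbove) :
    ∃ w : HeightOneSpectrum (𝓞 L), 𝔓.comap (ringOfIntegersToIntegralClosure (k := K) (Ω := AlgebraicClosure K) L) = w.asIdeal ∧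
      w.asIdeal.under (𝓞 K) = v.asIdeal := by
  haveI := h𝔓.1
  let j : 𝓞 L →+* absIntegers (𝓞 K) K := ringOfIntegersToIntegralClosure (k := K) (Ω := AlgebraicClosure K) L
  have hj : ∀ r : 𝓞 K, j (algebraMap (𝓞 K) (𝓞 L) r) = algebraMap (𝓞 K) (absIntegers (𝓞 K) K) r :=
    fun r ↦ RingHom.congr_fun (ringOfIntegersToIntegralClosure_comp_algebraMap (k := K) (Ω := AlgebraicClosure K) L) r
  set I : Ideal (𝓞 L) := 𝔓.comap j with hI
  haveI hIp : I.IsPrime := Ideal.comap_isPrime _ 𝔓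
  -- `I ≠ ⊥`: it contains the image of a nonzero element of `v`
  have hne : I ≠ ⊥ := by
    obtain ⟨r, hrv, hr0⟩ := Submodule.exists_mem_ne_zero_of_ne_bot v.ne_bot
    have hrI : algebraMap (𝓞 K) (𝓞 L) r ∈ I := by
      rw [hI, Ideal.mem_comap, hj, ← Ideal.mem_comap, ← Ideal.under_def, ← h𝔓.2.over]
      exact hrv
    intro h
    rw [h, Ideal.mem_bot] at hrI
    exact hr0 ((map_eq_zero_iff _ (FaithfulSMul.algebraMap_injective (𝓞 K) (𝓞 L))).1 hrI)
  let w : HeightOneSpectrum (𝓞 L) := ⟨I, hIp, hne⟩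
  have hunder : w.asIdeal.under (𝓞 K) = v.asIdeal := by
    rw [← KummerU.comap_algebraMap_eq_under_of_comap_eq L (w' := w) hI.symm]
    exact h𝔓.2.over.symm
  exact ⟨w, hI.symm, hunder⟩

variable {L 𝔓} in
/-- For `x ∈ L` with `v_w(x) ≤ 1` (`w` the place of `L` below the prime `𝔓`): `x ∈ \bar ℤ_𝔓` — write `x = a/s` with `a, s ∈ 𝓞 L`, `s ∉ 𝔭_w`
(`PadicEmbedding.exists_mul_eq_of_valuation_le_one`), so `s ∉ 𝔓`. [cite: NeukirchANT1999, Ch. II §8 (8.1)] -/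
theorem coe_mem_absIntegersValuationSubring_of_valuation_le_one [𝔓.IsMaximal] {w : HeightOneSpectrum (𝓞 L)}
    (hw : 𝔓.comap (ringOfIntegersToIntegralClosure (k := K) (Ω := AlgebraicClosure K) L) = w.asIdeal) {x : L}
    (hx : w.valuation L x ≤ 1) : ((x : L) : AlgebraicClosure K) ∈ absIntegersValuationSubring 𝔓 := by
  obtain ⟨a, s, hs, hsa⟩ := PadicEmbedding.exists_mul_eq_of_valuation_le_one w hx
  rw [mem_absIntegersValuationSubring_iff, mem_absIntegersLocalization_iff]
  refine ⟨ringOfIntegersToIntegralClosure (k := K) (Ω := AlgebraicClosure K) L a,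
    ringOfIntegersToIntegralClosure (k := K) (Ω := AlgebraicClosure K) L s, fun h ↦ hs ?_, ?_⟩
  · rw [← hw, Ideal.mem_comap]
    exact h
  · rw [coe_ringOfIntegersToIntegralClosure, coe_ringOfIntegersToIntegralClosure, ← hsa, IntermediateField.coe_mul, mul_comm]

variable {L 𝔓} in
/-- `v_w(x) < 1`, `x ≠ 0` ⟹ `x⁻¹ ∉ \bar ℤ_𝔓`: with `s x = a`, `a ∈ 𝔭_w ⊆ 𝔓`, `s ∉ 𝔓`, a fraction `x⁻¹ = m/d` (`d ∉ 𝔓`) would give `s d = a m ∈ 𝔓`.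
[cite: NeukirchANT1999, Ch. II §8 (8.1)] -/
theorem inv_coe_notMem_absIntegersValuationSubring_of_valuation_lt_one [𝔓.IsMaximal] {w : HeightOneSpectrum (𝓞 L)}
    (hw : 𝔓.comap (ringOfIntegersToIntegralClosure (k := K) (Ω := AlgebraicClosure K) L) = w.asIdeal) {x : L} (hx0 : x ≠ 0)
    (hx : w.valuation L x < 1) : (((x : L) : AlgebraicClosure K))⁻¹ ∉ absIntegersValuationSubring 𝔓 := by
  obtain ⟨a, s, hs, hsa⟩ := PadicEmbedding.exists_mul_eq_of_valuation_le_one w hx.le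
  -- `a ∈ 𝔭_w`
  have ha : a ∈ w.asIdeal := by
    have hsv : w.valuation L (s : L) = 1 := (HeightOneSpectrum.valuation_eq_one_iff_notMem w).2 hs
    have hav : w.valuation L (a : L) < 1 := by
      rw [← hsa, map_mul, hsv, one_mul]
      exact hx
    exact (HeightOneSpectrum.valuation_lt_one_iff_mem w a).1 hav
  have hja : ringOfIntegersToIntegralClosure (k := K) (Ω := AlgebraicClosure K) L a ∈ 𝔓 := by
    rw [← hw] at ha
    exact Ideal.mem_comap.mp ha
  have hjs : ringOfIntegersToIntegralClosure (k := K) (Ω := AlgebraicClosure K) L s ∉ 𝔓 :=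
    fun h ↦ hs (by rw [← hw]; exact Ideal.mem_comap.mpr h)
  intro hmem
  rw [mem_absIntegersValuationSubring_iff, mem_absIntegersLocalization_iff] at hmem
  obtain ⟨m, d, hd, hmd⟩ := hmem
  have hx0' : ((x : L) : AlgebraicClosure K) ≠ 0 := fun h ↦ hx0 (by exact_mod_cast h)
  -- `s d = a m` in `ℤ̄`
  let j : 𝓞 L →+* absIntegers (𝓞 K) K := ringOfIntegersToIntegralClosure (k := K) (Ω := AlgebraicClosure K) L
  have hsd : j s * d = j a * m := by
    apply Subtype.ext
    change ((s : L) : AlgebraicClosure K) * (d : AlgebraicClosure K) = ((a : L) : AlgebraicClosure K) * (m : AlgebraicClosure K)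
    rw [← hmd, ← hsa, IntermediateField.coe_mul]
    field_simp
  have hmem𝔓 : j s * d ∈ 𝔓 := by
    rw [hsd]
    exact Ideal.mul_mem_right _ _ hja
  exact (Ideal.IsPrime.mul_notMem (inferInstance : 𝔓.IsPrime) hjs hd) hmem𝔓

variable {L 𝔓} in
/-- **`x, x⁻¹ ∈ \bar ℤ_𝔓 ⟹ v_w(x) = 1`** for `x ∈ L` and the place `w` of `L` below `𝔓` (trichotomy with the previous lemma applied to `x` and
`x⁻¹`). [cite: NeukirchANT1999, Ch. II §8 (8.1)] -/
theorem valuation_eq_one_of_coe_mem [𝔓.IsMaximal] {w : HeightOneSpectrum (𝓞 L)}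
    (hw : 𝔓.comap (ringOfIntegersToIntegralClosure (k := K) (Ω := AlgebraicClosure K) L) = w.asIdeal) {x : L} (hx0 : x ≠ 0)
    (hx : ((x : L) : AlgebraicClosure K) ∈ absIntegersValuationSubring 𝔓)
    (hx' : (((x : L) : AlgebraicClosure K))⁻¹ ∈ absIntegersValuationSubring 𝔓) : w.valuation L x = 1 := by
  rcases lt_trichotomy (w.valuation L x) 1 with h | h | h
  · exact absurd hx' (inv_coe_notMem_absIntegersValuationSubring_of_valuation_lt_one hw hx0 h)
  · exact h
  · have hinv : w.valuation L x⁻¹ < 1 := by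
      rw [map_inv₀]
      exact inv_lt_one_of_one_lt₀ h
    have h2 := inv_coe_notMem_absIntegersValuationSubring_of_valuation_lt_one hw (inv_ne_zero hx0) hinv
    rw [IntermediateField.coe_inv, inv_inv] at h2
    exact absurd hx h2

end Units
/-! ## §2. The place below `σ • 𝔓` and products of conjugates -/

section Places

open Literature.NumberTheory.Automorphic

variable {K : Type} [Field K] [NumberField K] (F' : IntermediateField K (AlgebraicClosure K)) [NumberField F'] [IsGalois K F']

omit [NumberField K] [NumberField F'] in
/-- **The place below `σ • 𝔓` is `σ|_{F′} • (place below 𝔓)`**: `(σ • 𝔓) ∩ 𝓞 F′ = σ|_{F′} • (𝔓 ∩ 𝓞 F′)` (the restriction `Γ_K → Gal(F′/K)`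
intertwines the actions on `𝓞 F′ ⊆ \bar ℤ_K`, `ringOfIntegersToIntegralClosure_absRestrictNormalHom_smul`). [cite: NeukirchANT1999, Ch. I §9 (9.1)–(9.4)] -/
theorem comap_smul_eq_smul_asIdeal (w : HeightOneSpectrum (𝓞 F')) (𝔓 : Ideal (absIntegers (𝓞 K) K))
    (h𝔓 : 𝔓.comap (ringOfIntegersToIntegralClosure (k := K) (Ω := AlgebraicClosure K) F') = w.asIdeal) (σ : absoluteGaloisGroup K) :
    (σ • 𝔓).comap (ringOfIntegersToIntegralClosure (k := K) (Ω := AlgebraicClosure K) F') = (absRestrictNormalHom F' σ • w).asIdeal := by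
  rw [HeightOneSpectrum.smul_asIdeal, ← h𝔓]
  set j : 𝓞 F' →+* absIntegers (𝓞 K) K := ringOfIntegersToIntegralClosure (k := K) (Ω := AlgebraicClosure K) F' with hj
  have key : ∀ y : 𝓞 F', j (((absRestrictNormalHom F') σ)⁻¹ • y) = σ⁻¹ • j y := fun y ↦ by
    rw [← map_inv]
    exact ringOfIntegersToIntegralClosure_absRestrictNormalHom_smul F' σ⁻¹ y
  ext x
  calc x ∈ Ideal.comap j (σ • 𝔓)
        ↔ j x ∈ σ • 𝔓 := Ideal.mem_comap
    _ ↔ σ⁻¹ • j x ∈ 𝔓 := Ideal.mem_pointwise_smul_iff_inv_smul_mem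
    _ ↔ j ((absRestrictNormalHom F' σ)⁻¹ • x) ∈ 𝔓 := by rw [key]
    _ ↔ (absRestrictNormalHom F' σ)⁻¹ • x ∈ Ideal.comap j 𝔓 := Ideal.mem_comap.symm
    _ ↔ x ∈ absRestrictNormalHom F' σ • Ideal.comap j 𝔓 := Ideal.mem_pointwise_smul_iff_inv_smul_mem.symm

omit [NumberField K] [IsGalois K F'] in
/-- **`log v_w(∏_i g_i b) = #ι · log v_w(b)`** when every `g_i ∈ Gal(F′/K)` fixes the place `w` (`v_{g w}(g b) = v_w(b)`,
`HeightOneSpectrum.valuation_algEquiv_smul`). [cite: NeukirchANT1999, Ch. II §9] -/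
theorem log_valuation_prod_eq {ι : Type*} [Fintype ι] (w : HeightOneSpectrum (𝓞 F')) (g : ι → (F' ≃ₐ[K] F')) (hg : ∀ i, g i • w = w)
    (b : F') : WithZero.log (w.valuation F' (∏ i, g i b)) = (Fintype.card ι : ℤ) * WithZero.log (w.valuation F' b) := by
  have hfac : ∀ i, w.valuation F' (g i b) = w.valuation F' b := fun i ↦ by
    have h := HeightOneSpectrum.valuation_algEquiv_smul K (g i) w b
    rwa [hg i] at h
  rw [map_prod, Finset.prod_congr rfl fun i _ ↦ hfac i, Finset.prod_const, Finset.card_univ, WithZero.log_pow, nsmul_eq_mul]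

end Places

/-! ## §3. `[Γ_K : U] ∣ e(w″ ∣ v̄)`: the inertia group of `𝔓` generates `Γ_K` over `U` -/

section Index

variable {K : Type} [Field K] [NumberField K] (F F' : IntermediateField K (AlgebraicClosure K)) [FiniteDimensional K F'] [IsGalois K F']
  [NumberField F'] [(galFixing K F).Normal]

omit [NumberField K] [FiniteDimensional K F'] [NumberField F'] [(galFixing K F).Normal] in
/-- **Absolute inertia restricts into the finite-level inertia group**: `τ ∈ I_𝔓 ≤ Γ_K` ⟹ `τ|_{F′} ∈ I(𝔭_{w″})` for the place `w″` of `F′`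
below `𝔓` (`τ • y − y ∈ 𝔓 ∩ 𝓞 F′ = 𝔭_{w″}` for `y ∈ 𝓞 F′`). [cite: NeukirchANT1999, Ch. I §9 (9.4)] -/
theorem absRestrictNormalHom_mem_inertia (w : HeightOneSpectrum (𝓞 F')) (𝔓 : Ideal (absIntegers (𝓞 K) K))
    (h𝔓 : 𝔓.comap (ringOfIntegersToIntegralClosure (k := K) (Ω := AlgebraicClosure K) F') = w.asIdeal)
    {τ : absoluteGaloisGroup K} (hτ : τ ∈ 𝔓.inertia (absoluteGaloisGroup K)) :
    absRestrictNormalHom F' τ ∈ w.asIdeal.inertia (F' ≃ₐ[K] F') := by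
  rw [Ideal.inertia, AddSubgroup.mem_inertia] at hτ ⊢
  intro y
  have h1 := hτ (ringOfIntegersToIntegralClosure (k := K) (Ω := AlgebraicClosure K) F' y)
  rw [Submodule.mem_toAddSubgroup] at h1 ⊢
  have e1 : ringOfIntegersToIntegralClosure (k := K) (Ω := AlgebraicClosure K) F' (absRestrictNormalHom F' τ • y - y) =
      τ • ringOfIntegersToIntegralClosure (k := K) (Ω := AlgebraicClosure K) F' y -
        ringOfIntegersToIntegralClosure (k := K) (Ω := AlgebraicClosure K) F' y := by
    rw [map_sub, ringOfIntegersToIntegralClosure_absRestrictNormalHom_smul]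
  rw [← h𝔓, Ideal.mem_comap]
  exact e1 ▸ h1

/-- **`[Γ_K : U] ∣ e(w″ ∣ v̄)`.** `F ⊆ F′ ⊆ K̄` finite with `F′/K` Galois, `U = Gal(K̄/F)` normal, `𝔓 ∣ v̄` a prime of `\bar ℤ_K` with
`Γ_K = I_𝔓 · U` (total ramification of `v̄` in `F`), `w″` the place of `F′` below `𝔓`. Then the index `[Γ_K : U]` divides the ramification
index `e(w″ ∣ v̄)`: `e = #I(w″ ∣ v̄)` (`Ideal.card_inertia_eq_ramificationIdxIn`) and `I(w″ ∣ v̄) ⊇ I_𝔓|_{F′}` of order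
`[I_𝔓 : I_𝔓 ∩ Gal(K̄/F′)]`, a multiple of `[I_𝔓 : I_𝔓 ∩ U] = [I_𝔓 U : U] = [Γ_K : U]`. [cite: NeukirchANT1999, Ch. I §9 (9.4), (9.6)]
[cite: SerreLocalFields1979, I §7 Prop. 21–22] -/
theorem index_dvd_ramificationIdx (hU' : galFixing K F' ≤ galFixing K F) {vbar : HeightOneSpectrum (𝓞 K)}
    {𝔓 : Ideal (absIntegers (𝓞 K) K)} (h𝔓 : 𝔓 ∈ vbar.primesAbove) (w : HeightOneSpectrum (𝓞 F'))
    (h𝔓w : 𝔓.comap (ringOfIntegersToIntegralClosure (k := K) (Ω := AlgebraicClosure K) F') = w.asIdeal)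
    (htot : ∀ σ : absoluteGaloisGroup K, ∃ τ ∈ 𝔓.inertia (absoluteGaloisGroup K), τ⁻¹ * σ ∈ galFixing K F) :
    (galFixing K F).index ∣ vbar.asIdeal.ramificationIdx' w.asIdeal := by
  haveI := h𝔓.1
  haveI : Module.Finite (𝓞 K) (𝓞 F') := IsIntegralClosure.finite (𝓞 K) K F' (𝓞 F')
  haveI : IsGaloisGroup (F' ≃ₐ[K] F') (𝓞 K) (𝓞 F') := IsGaloisGroup.of_isFractionRing (F' ≃ₐ[K] F') (𝓞 K) (𝓞 F') K F'
  haveI := vbar.isPrime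
  haveI := w.isPrime
  have hunder : w.asIdeal.under (𝓞 K) = vbar.asIdeal := by
    rw [← KummerU.comap_algebraMap_eq_under_of_comap_eq F' h𝔓w]
    exact h𝔓.2.over.symm
  haveI : w.asIdeal.LiesOver vbar.asIdeal := ⟨hunder.symm⟩
  -- `e = #I(w ∣ v̄)`
  have he : vbar.asIdeal.ramificationIdx' w.asIdeal = Nat.card (w.asIdeal.inertia (F' ≃ₐ[K] F')) := by
    rw [Ideal.ramificationIdx'_eq_ramificationIdx vbar.asIdeal w.asIdeal vbar.ne_bot,
      ← Ideal.ramificationIdxIn_eq_ramificationIdx vbar.asIdeal w.asIdeal (F' ≃ₐ[K] F'),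
      ← Ideal.card_inertia_eq_ramificationIdxIn (G := F' ≃ₐ[K] F') vbar.asIdeal w.asIdeal]
  rw [he]
  -- the image `J` of `I_𝔓` in `Gal(F′/K)` sits inside `I(w ∣ v̄)`
  have hJ : (𝔓.inertia (absoluteGaloisGroup K)).map (absRestrictNormalHom F') ≤ w.asIdeal.inertia (F' ≃ₐ[K] F') := by
    rintro _ ⟨τ, hτ, rfl⟩
    exact absRestrictNormalHom_mem_inertia F' w 𝔓 h𝔓w hτ
  refine dvd_trans ?_ (Subgroup.card_dvd_of_le hJ)
  -- `#J = [I : I ∩ Gal(K̄/F′)]`, a multiple of `[I : I ∩ U] = [Γ_K : U]`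
  have hker1 : ∀ σ : absoluteGaloisGroup K, absRestrictNormalHom F' σ = 1 ↔ σ ∈ galFixing K F' := fun σ ↦
    (MonoidHom.mem_ker (f := AlgEquiv.restrictNormalHom F')).symm.trans (SetLike.ext_iff.mp (IntermediateField.restrictNormalHom_ker F') σ)
  have hker : (absRestrictNormalHom F').ker = galFixing K F' := Subgroup.ext fun σ ↦ MonoidHom.mem_ker.trans (hker1 σ)
  rw [← Subgroup.relIndex_ker (𝔓.inertia (absoluteGaloisGroup K)) (absRestrictNormalHom F'), hker]
  refine dvd_trans ?_ (Subgroup.relIndex_dvd_of_le_left (𝔓.inertia (absoluteGaloisGroup K)) hU')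
  -- `I ⊔ U = ⊤`
  have hsup : 𝔓.inertia (absoluteGaloisGroup K) ⊔ galFixing K F = ⊤ := by
    rw [eq_top_iff]
    intro σ _
    obtain ⟨τ, hτ, hτσ⟩ := htot σ
    have : σ = τ * (τ⁻¹ * σ) := by group
    rw [this]
    exact Subgroup.mul_mem_sup hτ hτσ
  rw [← Subgroup.relIndex_top_right, ← hsup, Subgroup.relIndex_sup_right]

end Index

/-! ## §4. THE TRANSFER `n ∣ ord_{w₀}(z)` (in `Z`) ⟹ `n ∣ ord_{w″}(b′)` (in `F′`) -/

section Transfer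

variable {K : Type} [Field K] [NumberField K] (Z F' : IntermediateField K (AlgebraicClosure K)) [NumberField Z] [NumberField F']
  (𝔓 : Ideal (absIntegers (𝓞 K) K)) [𝔓.IsMaximal] {vbar : HeightOneSpectrum (𝓞 K)}

/-- **THE TRANSFER.** `Z, F′ ⊆ K̄` finite over the number field `K`, `𝔓 ∣ v̄` a prime of `\bar ℤ_K`, `w₀` / `w″` the places of `Z` / `F′` below
`𝔓`, with `e(w₀ ∣ v̄) = 1` and `d ∣ e(w″ ∣ v̄)` (`d ≥ 1`). If `z ∈ Z` and `x ∈ F′` are THE SAME element of `K̄`, `log v_{w″}(x) = d · log v_{w″}(b′)`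
and `(n : ℤ) ∣ log v_{w₀}(z)`, then `(n : ℤ) ∣ log v_{w″}(b′)`: write `z = π^{−nk} u` with `π ∈ K` a `v̄`-uniformiser and `u` a `w₀`-unit of `Z`;
`u` is a unit of `\bar ℤ_𝔓` (§1), hence a `w″`-unit of `F′`; so `d · log v_{w″}(b′) = nk · e(w″ ∣ v̄)`. (Use: `Z = K_ε`, `F′ = F·K_ε`,
`z = ∏_y s_y b′ = N_{F′/K_ε} b′`, `d = [F : K]`; §2, §3.) [cite: NeukirchANT1999, Ch. II §8 (8.1)–(8.5)] [cite: SerreLocalFields1979, I §7 Prop. 21–22] -/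
theorem dvd_log_valuation_of_dvd_log_valuation_subfield (h𝔓 : 𝔓 ∈ vbar.primesAbove)
    (w₀ : HeightOneSpectrum (𝓞 Z)) (hw₀ : 𝔓.comap (ringOfIntegersToIntegralClosure (k := K) (Ω := AlgebraicClosure K) Z) = w₀.asIdeal)
    (w : HeightOneSpectrum (𝓞 F')) (hw : 𝔓.comap (ringOfIntegersToIntegralClosure (k := K) (Ω := AlgebraicClosure K) F') = w.asIdeal)
    (he₀ : vbar.asIdeal.ramificationIdx' w₀.asIdeal = 1) {d : ℕ} (hd : d ≠ 0) (hde : d ∣ vbar.asIdeal.ramificationIdx' w.asIdeal)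
    {z : Z} {x b' : F'} (hz0 : z ≠ 0) (hzx : ((z : Z) : AlgebraicClosure K) = ((x : F') : AlgebraicClosure K))
    (hx : WithZero.log (w.valuation F' x) = (d : ℤ) * WithZero.log (w.valuation F' b')) {n : ℕ}
    (hn : (n : ℤ) ∣ WithZero.log (w₀.valuation Z z)) : (n : ℤ) ∣ WithZero.log (w.valuation F' b') := by
  haveI := h𝔓.1
  haveI := vbar.isPrime
  -- the places lie over `v̄`
  have hunder₀ : w₀.asIdeal.under (𝓞 K) = vbar.asIdeal := by
    rw [← KummerU.comap_algebraMap_eq_under_of_comap_eq Z hw₀]; exact h𝔓.2.over.symm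
  have hunder : w.asIdeal.under (𝓞 K) = vbar.asIdeal := by
    rw [← KummerU.comap_algebraMap_eq_under_of_comap_eq F' hw]; exact h𝔓.2.over.symm
  haveI : w₀.asIdeal.LiesOver vbar.asIdeal := ⟨hunder₀.symm⟩
  haveI : w.asIdeal.LiesOver vbar.asIdeal := ⟨hunder.symm⟩
  -- a `v̄`-uniformiser `π ∈ K`; its valuations at `w₀` and `w`
  obtain ⟨π, hπ⟩ := HeightOneSpectrum.valuation_exists_uniformizer K vbar
  have hπ0 : π ≠ 0 := by
    intro h; rw [h, map_zero] at hπ; exact WithZero.zero_ne_coe hπ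
  have hπ₀ : w₀.valuation Z (algebraMap K Z π) = WithZero.exp (-1) := by
    rw [← HeightOneSpectrum.valuation_liesOver Z vbar w₀ π, he₀, pow_one, hπ]
  have hπw : WithZero.log (w.valuation F' (algebraMap K F' π)) = -(vbar.asIdeal.ramificationIdx' w.asIdeal : ℤ) := by
    rw [← HeightOneSpectrum.valuation_liesOver F' vbar w π, hπ, WithZero.log_pow, WithZero.log_exp, smul_neg, nsmul_eq_mul, mul_one]
  -- `z = π^{-nk} · u` with `u` a `w₀`-unit
  obtain ⟨k, hk⟩ := hn
  have hz : w₀.valuation Z z ≠ 0 := (Valuation.ne_zero_iff _).2 hz0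
  set u : Z := z * (algebraMap K Z π) ^ ((n : ℤ) * k) with hu
  have hπZ0 : algebraMap K Z π ≠ 0 := (map_ne_zero _).2 hπ0
  have hu0 : u ≠ 0 := mul_ne_zero hz0 (zpow_ne_zero _ hπZ0)
  have hval_u : w₀.valuation Z u = 1 := by
    have hne : w₀.valuation Z u ≠ 0 := (Valuation.ne_zero_iff _).2 hu0
    have hlog : WithZero.log (w₀.valuation Z u) = 0 := by
      rw [hu, map_mul, map_zpow₀, WithZero.log_mul hz (zpow_ne_zero _ ((Valuation.ne_zero_iff _).2 hπZ0)), WithZero.log_zpow, hπ₀,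
        WithZero.log_exp, hk]
      ring
    rw [← WithZero.exp_log hne, hlog, WithZero.exp_zero]
  -- `u`, `u⁻¹` are units of `\bar ℤ_𝔓`
  have hu1 : ((u : Z) : AlgebraicClosure K) ∈ absIntegersValuationSubring 𝔓 :=
    coe_mem_absIntegersValuationSubring_of_valuation_le_one hw₀ hval_u.le
  have hu2 : (((u : Z) : AlgebraicClosure K))⁻¹ ∈ absIntegersValuationSubring 𝔓 := by
    have h := coe_mem_absIntegersValuationSubring_of_valuation_le_one (𝔓 := 𝔓) hw₀ (x := u⁻¹) (by rw [map_inv₀, hval_u, inv_one])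
    rwa [IntermediateField.coe_inv] at h
  -- the same element read in `F′`
  set x' : F' := x * (algebraMap K F' π) ^ ((n : ℤ) * k) with hx'
  have hπF0 : algebraMap K F' π ≠ 0 := (map_ne_zero _).2 hπ0
  have hx0 : x ≠ 0 := by
    intro h
    apply hz0
    have : ((z : Z) : AlgebraicClosure K) = 0 := by rw [hzx, h]; rfl
    exact_mod_cast this
  have hx'0 : x' ≠ 0 := mul_ne_zero hx0 (zpow_ne_zero _ hπF0)
  have hcoe : ((x' : F') : AlgebraicClosure K) = ((u : Z) : AlgebraicClosure K) := by
    have e1 : ((x' : F') : AlgebraicClosure K) = ((x : F') : AlgebraicClosure K) * (algebraMap K (AlgebraicClosure K) π) ^ ((n : ℤ) * k) := by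
      rw [hx']
      change F'.val (x * (algebraMap K F' π) ^ ((n : ℤ) * k)) = F'.val x * _
      rw [map_mul, map_zpow₀, AlgHom.commutes]
    have e2 : ((u : Z) : AlgebraicClosure K) = ((z : Z) : AlgebraicClosure K) * (algebraMap K (AlgebraicClosure K) π) ^ ((n : ℤ) * k) := by
      rw [hu]
      change Z.val (z * (algebraMap K Z π) ^ ((n : ℤ) * k)) = Z.val z * _
      rw [map_mul, map_zpow₀, AlgHom.commutes]
    rw [e1, e2, hzx]
  have hval_x' : w.valuation F' x' = 1 :=
    valuation_eq_one_of_coe_mem hw hx'0 (hcoe ▸ hu1) (hcoe ▸ hu2)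
  -- read off the logarithms
  have hvx : w.valuation F' x ≠ 0 := (Valuation.ne_zero_iff _).2 hx0
  have hlog' : WithZero.log (w.valuation F' x) + (n : ℤ) * k * -(vbar.asIdeal.ramificationIdx' w.asIdeal : ℤ) = 0 := by
    have h := congrArg WithZero.log hval_x'
    rw [hx', map_mul, map_zpow₀, WithZero.log_mul hvx (zpow_ne_zero _ ((Valuation.ne_zero_iff _).2 hπF0)), WithZero.log_zpow, hπw,
      WithZero.log_one] at h
    rw [← h]
    ring
  obtain ⟨e', he'⟩ := hde
  rw [hx, he'] at hlog'
  refine ⟨k * e', ?_⟩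
  have hd0 : (d : ℤ) ≠ 0 := by exact_mod_cast hd
  apply mul_left_cancel₀ hd0
  push_cast at hlog'
  linear_combination hlog'

end Transfer

/-! ## §5. The conjugate places -/

section Conjugate

open Literature.NumberTheory.Automorphic

variable {K : Type} [Field K] (F' : IntermediateField K (AlgebraicClosure K)) [NumberField F']

omit [NumberField F'] in
/-- `ddⁿ = b · c`, `b, c ≠ 0`, `n ∣ log v_w(b)` ⟹ `n ∣ log v_w(c)`. [folklore] -/
theorem dvd_log_valuation_of_pow_eq_mul [NumberField F'] (w : HeightOneSpectrum (𝓞 F')) {b c dd : F'} (hb : b ≠ 0) (hc : c ≠ 0) {n : ℕ}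
    (h : dd ^ n = b * c) (hn : (n : ℤ) ∣ WithZero.log (w.valuation F' b)) : (n : ℤ) ∣ WithZero.log (w.valuation F' c) := by
  have hlog := congrArg (fun y ↦ WithZero.log (w.valuation F' y)) h
  simp only [map_pow, map_mul] at hlog
  rw [WithZero.log_pow, WithZero.log_mul ((Valuation.ne_zero_iff _).2 hb) ((Valuation.ne_zero_iff _).2 hc), nsmul_eq_mul] at hlog
  obtain ⟨k, hk⟩ := hn
  exact ⟨WithZero.log (w.valuation F' dd) - k, by linear_combination -hlog - hk⟩

/-- The valuation at a translated place: `v_{g • w}(b) = v_w(g⁻¹ b)`. [cite: NeukirchANT1999, Ch. II §9] -/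
theorem valuation_smul_place (g : F' ≃ₐ[K] F') (w : HeightOneSpectrum (𝓞 F')) (b : F') :
    (g • w).valuation F' b = w.valuation F' (g⁻¹ b) := by
  have h := HeightOneSpectrum.valuation_algEquiv_smul K g w (g⁻¹ b)
  rwa [show g (g⁻¹ b) = b from AlgEquiv.apply_symm_apply g b] at h

end Conjugate


end Summit.BirchSwinnertonDyer.BirchSwinnertonDyer.Theorems.PrintCf2.NormAtVbar

end
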